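import Summits.Ventures.PercRepro.LemmaBPlusSubs

/-!
# `K₅` with marks `0, 1, 2, 3` and the unmarked vertex `4`

The complete graph on five vertices (edges in the pair order `01, 02, 03, 04, 12, 13, 14, 23, 24, 34`).
Its cube has `3^10 = 59 049` faces and `4^10 = 1 048 576` face points; `LemmaBPlusK5A.lean` … `…N.lean`
decide Lemma B⁺ on all of them in 54 kernel slices (generated by `tools/gen_k5.py`, ≤ 22 000 points
each), `LemmaBPlusK5.lean` chains them.
-/

namespace PercRepro

namespace Examples

/-- `K₅`, marks `0 … 3`, hub `4`. -/
def k5 : MultiGraph (Fin 5) (Fin 10) :=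
  ⟨![0, 0, 0, 0, 1, 1, 1, 2, 2, 3], ![1, 2, 3, 4, 2, 3, 4, 3, 4, 4]⟩

end Examples

end PercRepro
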